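import Summits.HodgeConjecture.HodgeConjecture.Theorems.PadicSemiregularLiftFormalVectorBundlesAlgebraizeUnitFree
import Literature.AlgebraicGeometry.KTheory.PullbackVectorBundle

/-!
# The unit of `f^* ⊣ f_*` on a module which is free on an open of the target

Helper file for stub `stub_presentationAlgebraize` (EB2) of line `chow-zariski-pushforward` of the
crux `PadicSemiregularLift.FormalVectorBundlesAlgebraize` (`stmt-HodgeConjecture-14106`), continuing
`…AlgebraizeUnitFree` (the unit on FREE modules of finite rank). For a morphism of schemes
`f : Y ⟶ X`, an open `W ⊆ X` and an `𝒪_X`-module `V` with a frame `𝒪_W^I ≅ V|_W` (`I` finite; Mathlib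
`Scheme.Modules.restrictFunctor W.ι`):

* `unit_app_restrict` — **the unit commutes with restriction to `W`**: up to additive bijections on
  both sides, the unit `V ⟶ f_* f^* V` on sections over `W` IS the unit of `(f ∣_ W)^* ⊣ (f ∣_ W)_*`
  at `V|_W` on sections over `W`. Mathlib's `Scheme.Modules.pullback` is an abstract left adjoint, so
  this is derived from uniqueness of left adjoints: `f^* ⋙ (f⁻¹W ↪ Y)^*` and `(W ↪ X)^* ⋙ (f ∣_ W)^*`
  are both left adjoint to `(f⁻¹W ↪ Y)_* ⋙ f_* ≅ (f ∣_ W)_* ⋙ (W ↪ X)_*` (composite adjunctions with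
  Mathlib's `Scheme.Modules.restrictAdjunction`; `Adjunction.leftAdjointUniq` and its compatibility
  with units `Adjunction.unit_leftAdjointUniq_hom_app`);
* `unit_app_surjective_of_free`, `unit_app_eq_zero_of_free` — hence, by naturality of the unit in the
  frame and the free case: the unit is surjective on sections over `W` when `f♯` is, and a section over
  `W` killed by the unit is a `q`-th multiple when `ker (f♯ on W) ⊆ (q)`.

Everything is proved; no definitions. (Consumed by `…AlgebraizeUnitThickening`.)
-/

set_option linter.dupNamespace false
set_option backward.isDefEq.respectTransparency false

noncomputable section

-- Summit.HodgeConjecture.HodgeConjecture.… repeats the summit name by the D-0017 layout (Sub = Summit).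

open CategoryTheory CategoryTheory.Limits

universe u

namespace Summit.HodgeConjecture.HodgeConjecture.Theorems.FormalVectorBundlesAlgebraize

/-! ### The unit commutes with restriction to an open of the target -/

section Restrict

open AlgebraicGeometry TopologicalSpace Opposite

variable {X Y : Scheme.{u}} (f : Y ⟶ X) (W : X.Opens) (V : X.Modules)

/-- The two composite right adjoints `(f⁻¹W ↪ Y)_* ⋙ f_*` and `(f ∣_ W)_* ⋙ (W ↪ X)_*` agree
(`(f⁻¹W ↪ Y) ≫ f = (f ∣_ W) ≫ (W ↪ X)`, Mathlib `morphismRestrict_ι`). -/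
theorem nonempty_pushforward_restrict_iso :
    ∃ c : Scheme.Modules.pushforward (f ⁻¹ᵁ W).ι ⋙ Scheme.Modules.pushforward f ≅
        Scheme.Modules.pushforward (f ∣_ W) ⋙ Scheme.Modules.pushforward W.ι,
      ∀ (N : (↑(f ⁻¹ᵁ W) : Scheme.{u}).Modules) (O : X.Opens),
        (c.inv.app N).app O = N.presheaf.map (eqToHom (by
          change (f ⁻¹ᵁ W).ι ⁻¹ᵁ (f ⁻¹ᵁ O) = (f ∣_ W) ⁻¹ᵁ (W.ι ⁻¹ᵁ O)
          rw [← Scheme.Hom.comp_preimage, ← Scheme.Hom.comp_preimage, morphismRestrict_ι])).op := by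
  refine ⟨Scheme.Modules.pushforwardComp (f ⁻¹ᵁ W).ι f ≪≫
    Scheme.Modules.pushforwardCongr (morphismRestrict_ι f W).symm ≪≫
    (Scheme.Modules.pushforwardComp (f ∣_ W) W.ι).symm, fun N O => ?_⟩
  simp only [Iso.trans_inv, Iso.symm_inv, NatTrans.comp_app, Scheme.Modules.Hom.comp_app,
    Scheme.Modules.pushforwardComp_hom_app_app, Scheme.Modules.pushforwardCongr_inv_app_app,
    Scheme.Modules.pushforwardComp_inv_app_app, Category.comp_id, Category.id_comp]

/-- Restriction maps of an `𝒪_X`-module between equal opens are bijective. -/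
theorem presheaf_map_bijective_of_eq {S : Scheme.{u}} (M : S.Modules) {A B : S.Opens} (h : A = B)
    (i : op A ⟶ op B) : Function.Bijective (M.presheaf.map i) := by
  subst h
  rw [Subsingleton.elim i (𝟙 _), M.presheaf.map_id]
  exact Function.bijective_id

/-- The unit of `restrictFunctor U.ι ⊣ pushforward U.ι` (restriction of sections from `O` to
`U.ι '' (U.ι⁻¹ O) = O ∩ U`) is bijective on sections over `O = U`. -/
theorem restrictAdjunction_unit_app_bijective {S : Scheme.{u}} (U : S.Opens) (M : S.Modules) :
    Function.Bijective (((Scheme.Modules.restrictAdjunction U.ι).unit.app M).app U) := by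
  rw [Scheme.Modules.restrictAdjunction_unit_app_app]
  exact presheaf_map_bijective_of_eq M (by simp) _

/-- **The unit of `f^* ⊣ f_*` commutes with restriction to an open `W` of the target.** Up to
additive bijections on both sides (restrictions between equal opens, the components of the
comparison isomorphism `(f^*V)|_{f⁻¹W} ≅ (f ∣_ W)^*(V|_W)` of left adjoints of
`(f⁻¹W ↪ Y)_* f_* ≅ (f ∣_ W)_* (W ↪ X)_*`, Mathlib `Adjunction.leftAdjointUniq`), the unit
`V ⟶ f_* f^* V` on sections over `W` IS the unit `V|_W ⟶ (f ∣_ W)_* (f ∣_ W)^* (V|_W)` on sections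
over `W` (Mathlib `Adjunction.unit_leftAdjointUniq_hom_app`). -/
theorem unit_app_restrict :
    ∃ (α : Γ((Scheme.Modules.pushforward f).obj ((Scheme.Modules.pullback f).obj V), W) ≃+
        Γ((Scheme.Modules.pushforward (f ∣_ W)).obj ((Scheme.Modules.pullback (f ∣_ W)).obj
          ((Scheme.Modules.restrictFunctor W.ι).obj V)), W.ι ⁻¹ᵁ W))
      (β : Γ(V, W) ≃+ Γ((Scheme.Modules.restrictFunctor W.ι).obj V, W.ι ⁻¹ᵁ W)),
      ∀ s : Γ(V, W),
        α (((Scheme.Modules.pullbackPushforwardAdjunction f).unit.app V).app W s) =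
          ((Scheme.Modules.pullbackPushforwardAdjunction (f ∣_ W)).unit.app
            ((Scheme.Modules.restrictFunctor W.ι).obj V)).app (W.ι ⁻¹ᵁ W) (β s) := by
  obtain ⟨c, hc⟩ := nonempty_pushforward_restrict_iso f W
  let adj := Scheme.Modules.pullbackPushforwardAdjunction f
  let adjW := Scheme.Modules.pullbackPushforwardAdjunction (f ∣_ W)
  let adjj := Scheme.Modules.restrictAdjunction W.ι
  let adjj' := Scheme.Modules.restrictAdjunction (f ⁻¹ᵁ W).ι
  let adj₁ := adj.comp adjj'
  let adj₂ := adjj.comp adjW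
  let adj₂' := adj₂.ofNatIsoRight c.symm
  let e := adj₁.leftAdjointUniq adj₂'
  have key := adj₁.unit_leftAdjointUniq_hom_app adj₂' V
  have h₂ : adj₂'.unit.app V = adj₂.unit.app V ≫ c.inv.app _ := by
    change (adj₂.ofNatIsoRight c.symm).unit.app V = _
    rw [← Adjunction.homEquiv_id, Adjunction.homEquiv_ofNatIsoRight_apply, Adjunction.homEquiv_id]
    rfl
  rw [h₂] at key
  change (adj.unit.app V ≫ (Scheme.Modules.pushforward f).map (adjj'.unit.app _)) ≫ _ =
    (adjj.unit.app V ≫ (Scheme.Modules.pushforward W.ι).map (adjW.unit.app _)) ≫ c.inv.app _ at key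
  -- evaluate at `W`
  have keyW := fun s : Γ(V, W) => congrArg (fun g => Scheme.Modules.Hom.app g W s) key
  simp only [Scheme.Modules.Hom.comp_app, Functor.comp_map, Scheme.Modules.pushforward_map_app,
    ConcreteCategory.comp_apply, hc] at keyW
  -- the four auxiliary bijections
  have hE : (f ∣_ W) ⁻¹ᵁ (W.ι ⁻¹ᵁ W) = (f ⁻¹ᵁ W).ι ⁻¹ᵁ (f ⁻¹ᵁ W) := by
    rw [← Scheme.Hom.comp_preimage, ← Scheme.Hom.comp_preimage, morphismRestrict_ι]
  let N := (Scheme.Modules.pullback (f ∣_ W)).obj ((Scheme.Modules.restrictFunctor W.ι).obj V)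
  let u₁ := (adjj'.unit.app ((Scheme.Modules.pullback f).obj V)).app (f ⁻¹ᵁ W)
  have hu₁ : Function.Bijective u₁ := restrictAdjunction_unit_app_bijective _ _
  let eV := (e.hom.app V).app ((f ⁻¹ᵁ W).ι ⁻¹ᵁ f ⁻¹ᵁ W)
  have heV : Function.Bijective eV := ConcreteCategory.bijective_of_isIso eV
  let tE := N.presheaf.map (eqToHom hE.symm).op
  have htE : Function.Bijective tE := presheaf_map_bijective_of_eq N hE _
  let β : Γ(V, W) ≃+ Γ((Scheme.Modules.restrictFunctor W.ι).obj V, W.ι ⁻¹ᵁ W) :=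
    AddEquiv.ofBijective ((adjj.unit.app V).app W).hom (restrictAdjunction_unit_app_bijective W V)
  let α : Γ((Scheme.Modules.pushforward f).obj ((Scheme.Modules.pullback f).obj V), W) ≃+
      Γ((Scheme.Modules.pushforward (f ∣_ W)).obj N, W.ι ⁻¹ᵁ W) :=
    (AddEquiv.ofBijective u₁.hom hu₁).trans
      ((AddEquiv.ofBijective eV.hom heV).trans (AddEquiv.ofBijective tE.hom htE).symm)
  refine ⟨α, β, fun s => ?_⟩
  have hα : ∀ x, tE (α x) = eV (u₁ x) := fun x =>
    (AddEquiv.ofBijective tE.hom htE).apply_symm_apply (eV (u₁ x))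
  apply htE.1
  rw [hα]
  exact keyW s

/-- The restricted morphism `f ∣_ W` on sections over `W.ι⁻¹W`: it is `f.app` on the open
`W.ι '' (W.ι⁻¹ W)` followed by a bijection; so surjectivity transfers. -/
theorem morphismRestrict_app_surjective
    (hf : Function.Surjective (f.app (W.ι ''ᵁ (W.ι ⁻¹ᵁ W)))) :
    Function.Surjective ((f ∣_ W).app (W.ι ⁻¹ᵁ W)) := by
  rw [morphismRestrict_app]
  intro t
  obtain ⟨t', ht'⟩ := (ConcreteCategory.bijective_of_isIso
    (Y.presheaf.map (eqToHom (image_morphismRestrict_preimage f W (W.ι ⁻¹ᵁ W))).op)).2 t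
  obtain ⟨a, ha⟩ := hf t'
  exact ⟨a, by rw [← ht', ← ha]; rfl⟩

/-- … and the kernel is unchanged. -/
theorem morphismRestrict_app_ker_le (q : ℕ)
    (hq : RingHom.ker (f.app (W.ι ''ᵁ (W.ι ⁻¹ᵁ W))).hom ≤
      Ideal.span {(q : Γ(X, W.ι ''ᵁ (W.ι ⁻¹ᵁ W)))}) :
    RingHom.ker ((f ∣_ W).app (W.ι ⁻¹ᵁ W)).hom ≤ Ideal.span {(q : Γ(↑W, W.ι ⁻¹ᵁ W))} := by
  intro a ha
  refine hq ?_
  rw [RingHom.mem_ker] at ha ⊢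
  rw [morphismRestrict_app] at ha
  apply (ConcreteCategory.bijective_of_isIso
    (Y.presheaf.map (eqToHom (image_morphismRestrict_preimage f W (W.ι ⁻¹ᵁ W))).op)).1
  rw [map_zero]
  exact ha

variable {I : Type u} [Finite I]
  (eW : SheafOfModules.free (R := (W : Scheme.{u}).ringCatSheaf) I ≅
    (Scheme.Modules.restrictFunctor W.ι).obj V)

/-- The adjunction `(f ∣_ W)^* ⊣ (f ∣_ W)_*`. -/
local notation3 (prettyPrint := false) "adjW[" f' ", " W' "]" =>
  Scheme.Modules.pullbackPushforwardAdjunction (f' ∣_ W')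

include eW in
omit [Finite I] in
/-- Naturality of the unit of `(f ∣_ W)^* ⊣ (f ∣_ W)_*` in the frame `eW : 𝒪^I ≅ V|_W`, on sections. -/
theorem unit_app_frame_naturality (x : Γ(SheafOfModules.free (R := (W : Scheme.{u}).ringCatSheaf) I,
      W.ι ⁻¹ᵁ W)) :
    ((adjW[f, W]).unit.app ((Scheme.Modules.restrictFunctor W.ι).obj V)).app (W.ι ⁻¹ᵁ W)
        (Scheme.Modules.Hom.app eW.hom (W.ι ⁻¹ᵁ W) x) =
      ((Scheme.Modules.pullback (f ∣_ W) ⋙ Scheme.Modules.pushforward (f ∣_ W)).map eW.hom).app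
        (W.ι ⁻¹ᵁ W) (((adjW[f, W]).unit.app _).app (W.ι ⁻¹ᵁ W) x) := by
  have h := (adjW[f, W]).unit.naturality
    (eW.hom : (SheafOfModules.free I : (W : Scheme.{u}).Modules) ⟶
      (Scheme.Modules.restrictFunctor W.ι).obj V)
  have h' := congrArg (fun g => Scheme.Modules.Hom.app g (W.ι ⁻¹ᵁ W) x) h
  simp only [Functor.id_map, Scheme.Modules.Hom.comp_app, ConcreteCategory.comp_apply] at h'
  exact h'

include eW in
/-- **The unit is surjective on sections over an open `W` on which `V` is free, when `f♯` is
surjective on `W`** (`f♯` on the open `W.ι '' (W.ι⁻¹W) = W`). -/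
theorem unit_app_surjective_of_free
    (hf : Function.Surjective (f.app (W.ι ''ᵁ (W.ι ⁻¹ᵁ W)))) :
    Function.Surjective (((Scheme.Modules.pullbackPushforwardAdjunction f).unit.app V).app W) := by
  haveI := Literature.AlgebraicGeometry.KTheory.final_opensMap (f ∣_ W)
  haveI := Fintype.ofFinite I
  obtain ⟨α, β, hαβ⟩ := unit_app_restrict f W V
  have hfW := morphismRestrict_app_surjective f W hf
  -- surjectivity of the unit of `V|_W ≅ 𝒪^I`
  have hsurjW : Function.Surjective (((adjW[f, W]).unit.app
      ((Scheme.Modules.restrictFunctor W.ι).obj V)).app (W.ι ⁻¹ᵁ W)) := by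
    intro t
    let eGF := (Scheme.Modules.pullback (f ∣_ W) ⋙ Scheme.Modules.pushforward (f ∣_ W)).mapIso eW
    obtain ⟨x, hx⟩ := unit_free_app_surjective (f ∣_ W) I (W.ι ⁻¹ᵁ W) hfW
      ((eGF.inv.app (W.ι ⁻¹ᵁ W)) t)
    refine ⟨Scheme.Modules.Hom.app eW.hom (W.ι ⁻¹ᵁ W) x, ?_⟩
    rw [unit_app_frame_naturality f W V eW]
    change (eGF.hom.app (W.ι ⁻¹ᵁ W)) (((SheafOfModules.pullbackPushforwardAdjunction
      (f ∣_ W).toRingCatSheafHom).unit.app (SheafOfModules.free I)).val.app (op (W.ι ⁻¹ᵁ W)) x) = t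
    rw [hx, ← ConcreteCategory.comp_apply, ← Scheme.Modules.Hom.comp_app, eGF.inv_hom_id]
    rfl
  intro y
  obtain ⟨z, hz⟩ := hsurjW (α y)
  refine ⟨β.symm z, α.injective ?_⟩
  rw [hαβ, AddEquiv.apply_symm_apply, hz]

include eW in
/-- **The kernel of the unit on sections over an open `W` on which `V` is free**: if
`ker (f♯ on W) ⊆ (q)`, a section of `V` over `W` killed by the unit is a `q`-th multiple. -/
theorem unit_app_eq_zero_of_free (q : ℕ)
    (hq : RingHom.ker (f.app (W.ι ''ᵁ (W.ι ⁻¹ᵁ W))).hom ≤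
      Ideal.span {(q : Γ(X, W.ι ''ᵁ (W.ι ⁻¹ᵁ W)))})
    (s : Γ(V, W)) (hs : ((Scheme.Modules.pullbackPushforwardAdjunction f).unit.app V).app W s = 0) :
    ∃ y : Γ(V, W), s = q • y := by
  haveI := Literature.AlgebraicGeometry.KTheory.final_opensMap (f ∣_ W)
  haveI := Fintype.ofFinite I
  obtain ⟨α, β, hαβ⟩ := unit_app_restrict f W V
  have hqW := morphismRestrict_app_ker_le f W q hq
  -- `β s = eW x`, and the unit of `𝒪^I` kills `x`
  let x := Scheme.Modules.Hom.app eW.inv (W.ι ⁻¹ᵁ W) (β s)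
  have hx : Scheme.Modules.Hom.app eW.hom (W.ι ⁻¹ᵁ W) x = β s := by
    change (Scheme.Modules.Hom.app eW.inv (W.ι ⁻¹ᵁ W) ≫ Scheme.Modules.Hom.app eW.hom _) (β s) = β s
    rw [← Scheme.Modules.Hom.comp_app, eW.inv_hom_id]
    rfl
  have h0 : ((SheafOfModules.pullbackPushforwardAdjunction (f ∣_ W).toRingCatSheafHom).unit.app
      (SheafOfModules.free I)).val.app (op (W.ι ⁻¹ᵁ W)) x = 0 := by
    let eGF := (Scheme.Modules.pullback (f ∣_ W) ⋙ Scheme.Modules.pushforward (f ∣_ W)).mapIso eW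
    apply (ConcreteCategory.bijective_of_isIso (eGF.hom.app (W.ι ⁻¹ᵁ W))).1
    rw [map_zero]
    change ((Scheme.Modules.pullback (f ∣_ W) ⋙ Scheme.Modules.pushforward (f ∣_ W)).map eW.hom).app
      (W.ι ⁻¹ᵁ W) (((adjW[f, W]).unit.app _).app (W.ι ⁻¹ᵁ W) x) = 0
    rw [← unit_app_frame_naturality f W V eW, hx, ← hαβ, hs, map_zero]
  obtain ⟨x', hx'⟩ := unit_free_app_eq_zero (f ∣_ W) I (W.ι ⁻¹ᵁ W) q hqW x h0
  refine ⟨β.symm (Scheme.Modules.Hom.app eW.hom (W.ι ⁻¹ᵁ W) x'), β.injective ?_⟩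
  rw [← hx, map_nsmul, AddEquiv.apply_symm_apply, ← map_nsmul]
  exact congrArg _ hx'

end Restrict

section Stub

open AlgebraicGeometry

/-- **Registered sub-goal** (helper stub of `stub_presentationAlgebraize`, universe `0`): sections of
the unit of `f^* ⊣ f_*` over an open `W` on which the module is free — surjective when `f♯` is, and
with kernel inside the `q`-th multiples when `ker f♯ ⊆ (q)` (`unit_app_surjective_of_free`,
`unit_app_eq_zero_of_free`). -/
theorem stub_unitRestrictSections :
    ∀ (X Y : AlgebraicGeometry.Scheme.{0}) (f : Y ⟶ X) (W : X.Opens) (V : X.Modules) (I : Type) [Finite I], Nonempty (SheafOfModules.free (R := (W : AlgebraicGeometry.Scheme.{0}).ringCatSheaf) I ≅ (AlgebraicGeometry.Scheme.Modules.restrictFunctor W.ι).obj V) → (Function.Surjective (f.app (W.ι ''ᵁ (W.ι ⁻¹ᵁ W))) → Function.Surjective (((AlgebraicGeometry.Scheme.Modules.pullbackPushforwardAdjunction f).unit.app V).app W)) ∧ ∀ (q : ℕ), RingHom.ker (f.app (W.ι ''ᵁ (W.ι ⁻¹ᵁ W))).hom ≤ Ideal.span {(q : X.presheaf.obj (Opposite.op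 (W.ι ''ᵁ (W.ι ⁻¹ᵁ W))))} → ∀ s : (AlgebraicGeometry.Scheme.Modules.presheaf V).obj (Opposite.op W), ((AlgebraicGeometry.Scheme.Modules.pullbackPushforwardAdjunction f).unit.app V).app W s = 0 → ∃ y : (AlgebraicGeometry.Scheme.Modules.presheaf V).obj (Opposite.op W), s = q • y :=
  fun _ _ f W V _ _ ⟨eW⟩ => ⟨fun hf => unit_app_surjective_of_free f W V eW hf,
    fun q hq s hs => unit_app_eq_zero_of_free f W V eW q hq s hs⟩

end Stub

end Summit.HodgeConjecture.HodgeConjecture.Theorems.FormalVectorBundlesAlgebraize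

end
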